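import Summits.AnomalousDissipation.AnomalousDissipation.Theses.NeutralTaylorWaves
import Summits.AnomalousDissipation.AnomalousDissipation.Theorems.NeutralTaylorWavesNewtonRealisationStubDriftAbsorption
import Literature.Analysis.FluidPDE.SteadyNSLatticePersistenceDrift
import Literature.Analysis.FluidPDE.SteadyNSLatticeLinearised
import Literature.Analysis.FunctionSpaces.TorusVectorParseval

/-!
# Stub `stub_latticeDictionary` of the line `Sketch`
# (crux stmt-AnomalousDissipation-16315, `NeutralTaylorWaves.NewtonRealisation`)

LATTICE DICTIONARY between classical fields on `T³` and the Fourier-lattice state space `W` of the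
frame `Literature.Analysis.FluidPDE.SteadyLattice` / `SteadyLatticeDrift` (`W ⊂ ℓ²(ℤ³; ℂ³)`:
zero-mean, transversal, conjugate-symmetric families; an element `x` represents the physical
coefficients `x̌(k) = x(k)/|k|²`; `B(x, y)(k) = Π_k N(x̌, y̌)(k)`; the drift multiplier along `e₃`,
`(D₃ x)(k) = 2πi k₃ x̌(k)`), in three conjuncts:

* (D1) BASE STATE — a classical steady state `u₀ − c e₃` of `NS_ν(f₀)` (`u₀` smooth, divergence
  free, mean zero) gives `x₀ ∈ W` with `x̌₀ = 𝓕u₀` solving `(4π²ν)x₀ − cD₃x₀ + B(x₀,x₀) = Π𝓕f₀`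
  coordinatewise (`SteadyLatticeDrift.fourier_eq_drift_of_isSteadyNSState`: the zero mode of
  `𝓕(u₀ − ce₃)` is `complexify(−ce₃)`, its puncture is `𝓕u₀`, and `2πi k·(−ce₃) = −c·2πi k₃`);
* (D2) SYNTHESIS — a lattice solution `(x, β)` of `(4π²ν)x − βD₃x + B(x,x) = Π𝓕f` has rapidly
  decaying `x̌` (`SteadyLatticeDrift.rapidDecay_of_perturbed_eq` against the single mode
  `δ₀(complexify(−βe₃))`) and synthesises (`steadyState_of_fourier_drift`) a classical steady state
  `u'` of mean `−βe₃`; `u := u' + βe₃` is smooth, divergence free, mean zero, `𝓕u = x̌`, and solves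
  the drifted equation `u·∇u − νΔu + ∇p − β∂₃u = f` (Galilean identities of
  `Theorems.NewtonRealisation.DriftAbsorption`);
* (D3) FORCES — smooth `g₁, g₂` give `G₁, G₂ ∈ W` with coordinates `Π_k 𝓕gᵢ(k)` and
  `‖G₁ − G₂‖² ≤ ∫‖g₁ − g₂‖²` (`‖Π_k v‖ ≤ ‖v‖` and Parseval).

References: R. Temam, *Navier–Stokes Equations: Theory and Numerical Analysis* (1979), Ch. II §1;
folklore.
-/

set_option linter.dupNamespace false

noncomputable section

open scoped BigOperators Topology ENNReal NNReal InnerProductSpace ComplexConjugate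
open Filter Set Function MeasureTheory UnitAddTorus
open Literature.Analysis Literature.Analysis.FunctionSpaces Literature.Analysis.FunctionSpaces.Torus
open Literature.Analysis.FunctionSpaces.EuclideanSpace
open Literature.Analysis.FluidPDE.ScalarFourier
open Literature.Analysis.FluidPDE.SteadyLattice Literature.Analysis.FluidPDE.SteadyLatticeDrift

namespace Summit.AnomalousDissipation.AnomalousDissipation.Theorems.NewtonRealisation.LatticeDictionary

/-- The flat unit three-torus (local notation). -/
local notation "𝕋³" => UnitAddTorus (Fin 3)
/-- Velocity values (local notation). -/
local notation "E³" => EuclideanSpace ℝ (Fin 3)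

/-- Square-summable families `ℤ³ → ℂ³` (local notation). -/
local notation "ℓ2" => lp (fun _ : Fin 3 → ℤ => EuclideanSpace ℂ (Fin 3)) 2
/-- The physical coefficients `x̌(k) = x(k)/|k|²` of a lattice family (local notation, = the frame's `cf`). -/
local notation:max "cf[" x "]" =>
  ((fun mm : Fin 3 → ℤ => (((freqNormSq mm)⁻¹ : ℝ) : ℂ)) • (x : (Fin 3 → ℤ) → EuclideanSpace ℂ (Fin 3)))
/-- The coordinates of an element of `ℓ²` / of the state space (local notation). -/
local notation:max "cw[" x "]" => (((x : ℓ2)) : (Fin 3 → ℤ) → EuclideanSpace ℂ (Fin 3))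
/-- The convective symbol `N(a, b)(k)` as a vector of `ℂ³` (local notation, = the frame's `nl`). -/
local notation:max "nl[" a "," b "]" k:max =>
  (WithLp.toLp 2 (fun pp : Fin 3 => transportSym (fun jj mm => (a : (Fin 3 → ℤ) → EuclideanSpace ℂ (Fin 3)) mm jj)
    (fun mm => (b : (Fin 3 → ℤ) → EuclideanSpace ℂ (Fin 3)) mm pp) k) : EuclideanSpace ℂ (Fin 3))
/-- `k · v` for `k ∈ ℤ³`, `v ∈ ℂ³` (local notation, = the frame's `kdot`). -/
local notation:max "kdot[" k "," v "]" => (∑ jj : Fin 3, ((k jj : ℤ) : ℂ) * (v : EuclideanSpace ℂ (Fin 3)) jj)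

/-! ## Elementary facts -/

/-- Fourier coefficients of a constant vector field vanish off the zero frequency:
`𝓕(y ↦ v)(n) = (∫ e_{−n}) v = 0` for `n ≠ 0`. [folklore] -/
theorem mFourierCoeff_const_of_ne_zero (v : EuclideanSpace ℂ (Fin 3)) {n : Fin 3 → ℤ} (hn : n ≠ 0) :
    mFourierCoeff (fun _ : 𝕋³ => v) n = 0 := by
  rw [mFourierCoeff_eq_integral_volume, integral_smul_const, integral_mFourier,
    if_neg (neg_ne_zero.2 hn), zero_smul]

/-- The drift symbol along `e₃`: `2πi (k · complexify(−β e₃)) = −β · 2πi k₃`. [folklore] -/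
theorem driftCoeff_e3 (β : ℝ) (k : Fin 3 → ℤ) :
    2 * Real.pi * Complex.I * kdot[k, complexify (-(β • EuclideanSpace.single (2 : Fin 3) (1 : ℝ)) : E³)] =
      -(β : ℂ) * (2 * Real.pi * Complex.I * ((k (2 : Fin 3) : ℤ) : ℂ)) := by
  simp [Fin.sum_univ_three, complexify_apply]
  ring

/-! ## (D3) Forces: the elements `Π 𝓕g` of `W` and the Parseval bound -/

section Forces

variable {W : Submodule ℝ ℓ2}
  (hW : ∀ x : ℓ2, x ∈ W ↔ cw[x] 0 = 0 ∧ (∀ kk : Fin 3 → ℤ, kdot[kk, cw[x] kk] = 0) ∧ IsConjSymm cw[x])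
include hW

/-- **The Leray-projected coefficient family of a smooth field is an element of `W`**: for smooth
`g`, `k ↦ Π_k 𝓕g(k)` is rapidly decaying (`‖Π_k v‖ ≤ ‖v‖`), hence square summable, with zero
mode `Π_0 = 0`, transversal (`k · Π_k v = 0`) and conjugate symmetric
(`Π_{−k} conj v = conj Π_k v`, `𝓕g(−k) = conj 𝓕g(k)`). [folklore] -/
theorem exists_lerayCoeff_mem {g : 𝕋³ → E³} (hg : IsSmooth g) :
    ∃ G : W, ∀ k : Fin 3 → ℤ, cw[G] k = FluidPDE.Torus.lerayCoeff k (mFourierCoeff (complexify ∘ g) k) := by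
  set Gf : (Fin 3 → ℤ) → EuclideanSpace ℂ (Fin 3) := fun k =>
    FluidPDE.Torus.lerayCoeff k (mFourierCoeff (complexify ∘ g) k) with hGf
  have hr : RapidDecay Gf :=
    hg.complexify_comp.rapidDecay_mFourierCoeff.of_norm_le_mul (C := 1) fun k => by
      rw [one_mul]; exact norm_lerayCoeff_le k _
  have hcs : IsConjSymm (mFourierCoeff (complexify ∘ g)) := isConjSymm_mFourierCoeff hg.integrable
  have hV : (Gf : (Fin 3 → ℤ) → EuclideanSpace ℂ (Fin 3)) 0 = 0 ∧
      (∀ kk : Fin 3 → ℤ, kdot[kk, (Gf : (Fin 3 → ℤ) → EuclideanSpace ℂ (Fin 3)) kk] = 0) ∧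
      IsConjSymm (Gf : (Fin 3 → ℤ) → EuclideanSpace ℂ (Fin 3)) := by
    refine ⟨FluidPDE.Torus.lerayCoeff_zero _, fun k => kdot_lerayCoeff k _, fun k => ?_⟩
    change FluidPDE.Torus.lerayCoeff (-k) (mFourierCoeff (complexify ∘ g) (-k)) =
      conjVec (FluidPDE.Torus.lerayCoeff k (mFourierCoeff (complexify ∘ g) k))
    rw [hcs k, lerayCoeff_neg_conjVec]
  exact ⟨⟨⟨Gf, memℓp_two_of_rapidDecay hr⟩, (hW _).2 hV⟩, fun k => rfl⟩

/-- **(D3) FORCES.** Smooth (mean-zero) `g₁, g₂` give `G₁, G₂ ∈ W` with coordinates `Π_k 𝓕gᵢ(k)`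
and `‖G₁ − G₂‖² = Σ_k ‖Π_k 𝓕(g₁ − g₂)(k)‖² ≤ Σ_k ‖𝓕(g₁ − g₂)(k)‖² = ∫‖g₁ − g₂‖²` (Parseval,
`Torus.integral_norm_sq_eq_tsum`). [folklore] -/
theorem dictionary_forces :
    ∀ (g₁ g₂ : 𝕋³ → E³), IsSmooth g₁ → HasZeroMean g₁ → IsSmooth g₂ → HasZeroMean g₂ →
      ∃ G₁ G₂ : W, (∀ k : Fin 3 → ℤ, cw[G₁] k = FluidPDE.Torus.lerayCoeff k (mFourierCoeff (complexify ∘ g₁) k)) ∧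
        (∀ k : Fin 3 → ℤ, cw[G₂] k = FluidPDE.Torus.lerayCoeff k (mFourierCoeff (complexify ∘ g₂) k)) ∧
        ‖G₁ - G₂‖ ^ 2 ≤ MeasureTheory.integral MeasureTheory.volume (fun y => ‖g₁ y - g₂ y‖ ^ 2) := by
  intro g₁ g₂ hg₁ _ hg₂ _
  obtain ⟨G₁, hG₁⟩ := exists_lerayCoeff_mem hW hg₁
  obtain ⟨G₂, hG₂⟩ := exists_lerayCoeff_mem hW hg₂
  refine ⟨G₁, G₂, hG₁, hG₂, ?_⟩
  have hv : IsSmooth (fun y => g₁ y - g₂ y) := hg₁.sub hg₂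
  have e : (complexify ∘ fun y => g₁ y - g₂ y : 𝕋³ → EuclideanSpace ℂ (Fin 3)) =
      (complexify ∘ g₁) - (complexify ∘ g₂) := by
    funext y; simp
  have hcoef : ∀ k : Fin 3 → ℤ, cw[(G₁ - G₂ : W)] k =
      FluidPDE.Torus.lerayCoeff k (mFourierCoeff (complexify ∘ fun y => g₁ y - g₂ y) k) := by
    intro k
    rw [coeW_sub, Pi.sub_apply, hG₁ k, hG₂ k, ← lerayCoeff_sub', e,
      mFourierCoeff_sub hg₁.complexify_comp.integrable hg₂.complexify_comp.integrable]
  have hle : ∀ k : Fin 3 → ℤ, ‖cw[(G₁ - G₂ : W)] k‖ ^ 2 ≤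
      ‖mFourierCoeff (complexify ∘ fun y => g₁ y - g₂ y) k‖ ^ 2 := fun k => by
    rw [hcoef k]
    exact pow_le_pow_left₀ (norm_nonneg _) (norm_lerayCoeff_le k _) 2
  calc ‖G₁ - G₂‖ ^ 2 = ∑' k : Fin 3 → ℤ, ‖cw[(G₁ - G₂ : W)] k‖ ^ 2 := by
        rw [← norm_coeW]; exact l2_norm_sq_eq_tsum _
    _ ≤ ∑' k : Fin 3 → ℤ, ‖mFourierCoeff (complexify ∘ fun y => g₁ y - g₂ y) k‖ ^ 2 :=
        (l2_hasSum_norm_sq _).summable.tsum_le_tsum hle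
          (hasSum_sq_norm_mFourierCoeff_complexify (hv.memLp 2)).summable
    _ = ∫ y, ‖g₁ y - g₂ y‖ ^ 2 := (integral_norm_sq_eq_tsum (hv.memLp 2)).symm

end Forces

/-! ## (D1) Base state: from the classical steady state `u₀ − c e₃` to `x₀ ∈ W` -/

section BaseState

variable {W : Submodule ℝ ℓ2}
  (hW : ∀ x : ℓ2, x ∈ W ↔ cw[x] 0 = 0 ∧ (∀ kk : Fin 3 → ℤ, kdot[kk, cw[x] kk] = 0) ∧ IsConjSymm cw[x])
  {B : W → W → W} (hB : ∀ x y : W, cw[B x y] = fun k => FluidPDE.Torus.lerayCoeff k (nl[cf[cw[x]], cf[cw[y]]] k))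
  {D₃ : W →L[ℝ] W}
  (hD₃ : ∀ x : W, cw[D₃ x] = fun k => (2 * Real.pi * Complex.I * ((k (2 : Fin 3) : ℤ) : ℂ)) • cf[cw[x]] k)
include hW hB hD₃

/-- **(D1) BASE STATE.** A classical steady state `u₀ − c e₃` of `NS_ν(f₀)` with `u₀` smooth,
divergence free and mean zero gives the base point `x₀ = (|k|² 𝓕u₀(k))_k ∈ W`, `x̌₀ = 𝓕u₀`,
solving the drifted lattice equation `(4π²ν)x₀ − cD₃x₀ + B(x₀,x₀) = Π𝓕f₀` coordinatewise: the
full family of `u₀ − ce₃` has zero mode `complexify(−ce₃)` (`mFourierCoeff_complexify_zero`) and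
puncture `𝓕u₀` (`𝓕u₀(0) = 0`, constants have no nonzero modes), so
`SteadyLatticeDrift.fourier_eq_drift_of_isSteadyNSState` is the claim, with drift symbol
`2πi k·(−ce₃) = −c·2πi k₃`. [folklore] -/
theorem dictionary_baseState :
    ∀ (ν : ℝ) (f₀ u₀ : 𝕋³ → E³) (p₀ : 𝕋³ → ℝ) (c : ℝ), 0 < ν → IsSmooth f₀ → HasZeroMean f₀ →
      IsSmooth u₀ → IsDivFree u₀ → HasZeroMean u₀ →
      FluidPDE.Torus.IsSteadyNSState ν f₀ (fun x => u₀ x - c • EuclideanSpace.single (2 : Fin 3) (1 : ℝ)) p₀ →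
      ∃ x₀ : W, cf[cw[x₀]] = mFourierCoeff (complexify ∘ u₀) ∧
        ∀ k : Fin 3 → ℤ, cw[((4 * Real.pi ^ 2 * ν) • x₀ - c • D₃ x₀ + B x₀ x₀ : W)] k =
          FluidPDE.Torus.lerayCoeff k (mFourierCoeff (complexify ∘ f₀) k) := by
  intro ν f₀ u₀ p₀ c _ hf₀ _ hu₀ hdiv₀ hu₀m hst
  -- the coefficients of `u₀`
  set b : (Fin 3 → ℤ) → EuclideanSpace ℂ (Fin 3) := mFourierCoeff (complexify ∘ u₀) with hb
  have hbr : RapidDecay b := hu₀.complexify_comp.rapidDecay_mFourierCoeff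
  have hbt : ∀ m : Fin 3 → ℤ, kdot[m, b m] = 0 := fun m => hdiv₀.sum_mul_mFourierCoeff_eq_zero hu₀ m
  have hbcs : IsConjSymm b := isConjSymm_mFourierCoeff hu₀.integrable
  have hb0 : b 0 = 0 := mFourierCoeff_complexify_zero_of_hasZeroMean hu₀ hu₀m
  -- the full family of `u₀ − c e₃`: zero mode and puncture
  have hU : IsSmooth (fun x => u₀ x - c • (EuclideanSpace.single (2 : Fin 3) (1 : ℝ) : E³)) :=
    hu₀.sub (isSmooth_const _)
  have ha0 : mFourierCoeff (complexify ∘ fun x => u₀ x - c • (EuclideanSpace.single (2 : Fin 3) (1 : ℝ) : E³)) 0 =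
      complexify (-(c • EuclideanSpace.single (2 : Fin 3) (1 : ℝ)) : E³) := by
    rw [mFourierCoeff_complexify_zero hU]
    congr 1
    have h0 : ∫ x, u₀ x = 0 := hu₀m
    rw [integral_sub hu₀.integrable (integrable_const _), integral_const, probReal_univ, one_smul, h0,
      zero_sub]
  have hupd : Function.update
      (mFourierCoeff (complexify ∘ fun x => u₀ x - c • (EuclideanSpace.single (2 : Fin 3) (1 : ℝ) : E³))) 0 0 =
      b := by
    funext k
    by_cases hk : k = 0
    · subst hk; rw [Function.update_self, hb0]
    · rw [Function.update_of_ne hk, hb]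
      have e : (complexify ∘ fun x => u₀ x - c • (EuclideanSpace.single (2 : Fin 3) (1 : ℝ) : E³) :
          𝕋³ → EuclideanSpace ℂ (Fin 3)) =
          (complexify ∘ u₀) - fun _ => complexify (c • (EuclideanSpace.single (2 : Fin 3) (1 : ℝ) : E³)) := by
        funext y; simp
      rw [e, mFourierCoeff_sub hu₀.complexify_comp.integrable (integrable_const _),
        mFourierCoeff_const_of_ne_zero _ hk, sub_zero]
  -- the drifted lattice equations of the steady state, for the punctured family `b`
  have hdrift : ∀ k : Fin 3 → ℤ, (((ν * (4 * Real.pi ^ 2 * freqNormSq k)) : ℝ) : ℂ) • b k +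
      (-(c : ℂ) * (2 * Real.pi * Complex.I * ((k (2 : Fin 3) : ℤ) : ℂ))) • b k +
      FluidPDE.Torus.lerayCoeff k (nl[b, b] k) =
      FluidPDE.Torus.lerayCoeff k (mFourierCoeff (complexify ∘ f₀) k) := by
    intro k
    have h := fourier_eq_drift_of_isSteadyNSState hst hf₀ k
    rw [hupd, ha0, driftCoeff_e3] at h
    exact h
  -- the base point
  set X₀ : (Fin 3 → ℤ) → EuclideanSpace ℂ (Fin 3) := fun k => ((freqNormSq k : ℝ) : ℂ) • b k with hX₀
  have hX₀r : RapidDecay X₀ := by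
    refine hbr.of_norm_le_mul_pow (C := 1) (s := 1) fun k => ?_
    rw [hX₀]
    dsimp only
    rw [norm_smul, Complex.norm_real, Real.norm_of_nonneg (freqNormSq_nonneg k), one_mul, pow_one]
    exact mul_le_mul_of_nonneg_right (by linarith [freqNormSq_nonneg k]) (norm_nonneg _)
  have hX00 : X₀ 0 = 0 := by simp [hX₀, freqNormSq_zero]
  have hX₀V : (X₀ : (Fin 3 → ℤ) → EuclideanSpace ℂ (Fin 3)) 0 = 0 ∧
      (∀ kk : Fin 3 → ℤ, kdot[kk, (X₀ : (Fin 3 → ℤ) → EuclideanSpace ℂ (Fin 3)) kk] = 0) ∧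
      IsConjSymm (X₀ : (Fin 3 → ℤ) → EuclideanSpace ℂ (Fin 3)) := by
    refine ⟨hX00, fun k => by rw [hX₀]; dsimp only; rw [kdot_smul, hbt k, mul_zero], fun k => ?_⟩
    rw [hX₀]
    dsimp only
    rw [freqNormSq_neg, hbcs k, conjVec_smul, Complex.conj_ofReal]
  set x₀ : W := ⟨⟨X₀, memℓp_two_of_rapidDecay hX₀r⟩, (hW _).2 hX₀V⟩ with hx₀def
  have hx₀ : cw[x₀] = X₀ := rfl
  have hcfX : cf[X₀] = b := by rw [hX₀]; exact cf_weight_smul hb0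
  refine ⟨x₀, by rw [hx₀]; exact hcfX, fun k => ?_⟩
  rw [coeW_add, coeW_sub, coeW_smul, coeW_smul, hB, hD₃]
  simp only [Pi.add_apply, Pi.sub_apply, Pi.smul_apply]
  rw [hx₀, hcfX, ← Complex.coe_smul, ← Complex.coe_smul, smul_eq_weight_smul_cf hX00 k, hcfX, ← hdrift k,
    smul_smul, neg_mul, neg_smul, sub_eq_add_neg]

end BaseState

/-! ## (D2) Synthesis: from a lattice solution `(x, β)` to a classical drifted steady state -/

section Synthesis

variable {W : Submodule ℝ ℓ2}
  (hW : ∀ x : ℓ2, x ∈ W ↔ cw[x] 0 = 0 ∧ (∀ kk : Fin 3 → ℤ, kdot[kk, cw[x] kk] = 0) ∧ IsConjSymm cw[x])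
  {B : W → W → W} (hB : ∀ x y : W, cw[B x y] = fun k => FluidPDE.Torus.lerayCoeff k (nl[cf[cw[x]], cf[cw[y]]] k))
  {D₃ : W →L[ℝ] W}
  (hD₃ : ∀ x : W, cw[D₃ x] = fun k => (2 * Real.pi * Complex.I * ((k (2 : Fin 3) : ℤ) : ℂ)) • cf[cw[x]] k)
include hW hB hD₃

/-- **(D2) SYNTHESIS.** A lattice solution `(x, β) ∈ W × ℝ` of `(4π²ν)x − βD₃x + B(x,x) = Π𝓕f`
(`f` smooth, divergence free, mean zero, so `Π𝓕f = 𝓕f`) has rapidly decaying `x̌`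
(`SteadyLatticeDrift.rapidDecay_of_perturbed_eq` against the single mode `δ₀M`,
`M = complexify(−βe₃)`, whose projected linearised symbol is the drift `−β·2πi k₃`), and
`SteadyLatticeDrift.steadyState_of_fourier_drift` synthesises a classical steady state `u'` of
`NS_ν(f)` with `𝓕u' = x̌ + δ₀M`, i.e. of mean `−βe₃`; the field `u = u' + βe₃` is smooth,
divergence free, mean zero, has `𝓕u = x̌`, and the momentum equation of `u' = u − βe₃`
rearranges to the drifted equation `u·∇u − νΔu + ∇p − β∂₃u = f`
(`(u − βe₃)·∇(u − βe₃) = u·∇u − β∂₃u`, `Δ(u − βe₃) = Δu`). [folklore] -/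
theorem dictionary_synthesis :
    ∀ (ν : ℝ) (f : 𝕋³ → E³) (x : W) (β : ℝ), 0 < ν → IsSmooth f → IsDivFree f → HasZeroMean f →
      (∀ k : Fin 3 → ℤ, cw[((4 * Real.pi ^ 2 * ν) • x - β • D₃ x + B x x : W)] k =
          FluidPDE.Torus.lerayCoeff k (mFourierCoeff (complexify ∘ f) k)) →
      ∃ (u : 𝕋³ → E³) (p : 𝕋³ → ℝ), IsSmooth u ∧ IsSmooth p ∧ IsDivFree u ∧ HasZeroMean u ∧
        (∀ y, Torus.convect u u y - ν • Torus.laplacian u y + Torus.gradient p y -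
            β • Torus.partialDeriv (2 : Fin 3) u y = f y) ∧
        mFourierCoeff (complexify ∘ u) = cf[cw[x]] := by
  intro ν f x β hν hf hfd hf0 heq
  -- the drift vector `M = complexify(−βe₃)` and its symbol
  set M : EuclideanSpace ℂ (Fin 3) := complexify (-(β • EuclideanSpace.single (2 : Fin 3) (1 : ℝ)) : E³) with hM
  have hMc : conjVec M = M := by rw [hM]; exact conjVec_complexify _
  have hkM : ∀ k : Fin 3 → ℤ, 2 * Real.pi * Complex.I * kdot[k, M] =
      -(β : ℂ) * (2 * Real.pi * Complex.I * ((k (2 : Fin 3) : ℤ) : ℂ)) := fun k => by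
    rw [hM]; exact driftCoeff_e3 β k
  -- the force coefficients: `Π 𝓕f = 𝓕f`
  set F : (Fin 3 → ℤ) → EuclideanSpace ℂ (Fin 3) := mFourierCoeff (complexify ∘ f) with hF
  have hFr : RapidDecay F := hf.complexify_comp.rapidDecay_mFourierCoeff
  have hFt : ∀ k : Fin 3 → ℤ, kdot[k, F k] = 0 := fun k => hfd.sum_mul_mFourierCoeff_eq_zero hf k
  have hF0 : F 0 = 0 := mFourierCoeff_complexify_zero_of_hasZeroMean hf hf0
  have hPF : ∀ k : Fin 3 → ℤ, FluidPDE.Torus.lerayCoeff k (F k) = F k := fun k => by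
    by_cases hk : k = 0
    · subst hk; rw [hF0, lerayCoeff_zero_vec]
    · exact lerayCoeff_of_kdot_eq_zero hk (hFt k)
  -- the coordinates of the lattice equation
  have hco : ∀ k : Fin 3 → ℤ, (((4 * Real.pi ^ 2 * ν : ℝ)) : ℂ) • cw[x] k +
      (-(β : ℂ) * (2 * Real.pi * Complex.I * ((k (2 : Fin 3) : ℤ) : ℂ))) • cf[cw[x]] k +
      FluidPDE.Torus.lerayCoeff k (nl[cf[cw[x]], cf[cw[x]]] k) = F k := by
    intro k
    have h := heq k
    rw [coeW_add, coeW_sub, coeW_smul, coeW_smul, hB, hD₃, hPF] at h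
    simp only [Pi.add_apply, Pi.sub_apply, Pi.smul_apply] at h
    rw [← Complex.coe_smul, ← Complex.coe_smul, smul_smul] at h
    rw [neg_mul, neg_smul, ← sub_eq_add_neg]
    exact h
  -- rapid decay of `x̌`
  have hxr : RapidDecay cf[cw[x]] :=
    rapidDecay_of_perturbed_eq hν (rapidDecay_single M) (single_transversal M) (x : ℓ2) (W_trans hW x)
      (F := F) (fun s => tsum_weight_mul_enorm_ne_top_of_rapidDecay hFr s)
      (fun k => by
        rw [leray_nl_linearised_single M (W_trans hW x) k, hkM k]
        exact hco k)
  -- the drifted steady lattice equations for `x̌` with drift vector `M`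
  have heq' : ∀ k : Fin 3 → ℤ, (((ν * (4 * Real.pi ^ 2 * freqNormSq k)) : ℝ) : ℂ) • cf[cw[x]] k +
      (2 * Real.pi * Complex.I * kdot[k, M]) • cf[cw[x]] k +
      FluidPDE.Torus.lerayCoeff k (nl[cf[cw[x]], cf[cw[x]]] k) = mFourierCoeff (complexify ∘ f) k := by
    intro k
    rw [hkM k, ← smul_eq_weight_smul_cf (W_zero hW x) k]
    exact hco k
  obtain ⟨u', p, hst', hu', hû'⟩ := steadyState_of_fourier_drift hf hfd hf0 hxr (isConjSymm_cf (W_conj hW x))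
    (cf_transversal (W_trans hW x)) (cf_zero _) hMc heq'
  have hp : IsSmooth p := hst'.smooth_pressure.isSmooth_slice (Set.mem_univ 0)
  have hdiv' : IsDivFree u' := hst'.divFree 0 (Set.mem_univ 0)
  have hu'1 : IsContDiff 1 u' := hu'.isContDiff (by simp)
  -- the momentum equation of `u'`
  have hmom' : ∀ y, Torus.convect u' u' y = ν • Torus.laplacian u' y - Torus.gradient p y + f y := by
    intro y
    have hm := hst'.momentum 0 (Set.mem_univ 0) y
    have ht : Torus.timeDerivWithin Set.univ (fun _ : ℝ => u') 0 y = 0 := by simp [Torus.timeDerivWithin]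
    rw [ht, zero_add] at hm
    exact hm
  -- restore the mean: `u = u' − (−β)e₃ = u' + βe₃`; its coefficients are `x̌ + δ₀M + δ₀ complexify(βe₃) = x̌`
  have hu : IsSmooth (fun y => u' y - (-β) • (EuclideanSpace.single (2 : Fin 3) (1 : ℝ) : E³)) :=
    hu'.sub (isSmooth_const _)
  have hcoefu : mFourierCoeff (complexify ∘ fun y => u' y - (-β) • (EuclideanSpace.single (2 : Fin 3) (1 : ℝ) : E³)) =
      cf[cw[x]] := by
    have e : (complexify ∘ fun y => u' y - (-β) • (EuclideanSpace.single (2 : Fin 3) (1 : ℝ) : E³) :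
        𝕋³ → EuclideanSpace ℂ (Fin 3)) =
        (complexify ∘ u') - fun _ => complexify ((-β) • (EuclideanSpace.single (2 : Fin 3) (1 : ℝ) : E³)) := by
      funext y; simp
    rw [e]
    funext k
    rw [mFourierCoeff_sub hu'.complexify_comp.integrable (integrable_const _), hû', Pi.add_apply]
    by_cases hk : k = 0
    · subst hk
      rw [Pi.single_eq_same, mFourierCoeff_eq_integral_volume, integral_smul_const, integral_mFourier]
      simp only [neg_zero, if_true, one_smul]
      rw [hM, neg_smul, add_sub_cancel_right]
    · rw [Pi.single_eq_of_ne hk, add_zero, mFourierCoeff_const_of_ne_zero _ hk, sub_zero]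
  refine ⟨fun y => u' y - (-β) • EuclideanSpace.single (2 : Fin 3) (1 : ℝ), p, hu, hp,
    DriftAbsorption.isDivFree_sub_const hdiv' _, ?_, fun y => ?_, hcoefu⟩
  · -- mean zero: `complexify (∫ u) = 𝓕u(0) = x̌(0) = 0`
    have h1 := mFourierCoeff_complexify_zero hu
    rw [congrFun hcoefu 0, cf_zero] at h1
    have h2 : (∫ y, (u' y - (-β) • (EuclideanSpace.single (2 : Fin 3) (1 : ℝ) : E³))) = 0 :=
      complexify_injective (by rw [← h1, map_zero])
    exact h2
  · -- the drifted momentum equation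
    rw [DriftAbsorption.convect_sub_smul_single hu'1, DriftAbsorption.torusLaplacian_sub_const,
      DriftAbsorption.torusPartialDeriv_sub_const, hmom' y, neg_smul, sub_neg_eq_add]
    abel

end Synthesis

/-! ## The stub -/

/-- **LATTICE DICTIONARY** (the registered stub `stub_latticeDictionary` of the line `Sketch`): in
the frame of `SteadyLattice` / `SteadyLatticeDrift` (state space `W` characterised by `hW`,
bilinear map `B` by `hB`, drift multiplier `D₃` along `e₃` by `hD₃`),
(D1) a classical steady state `u₀ − ce₃` of `NS_ν(f₀)` (`u₀` smooth, divergence free, mean zero)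
gives `x₀ ∈ W` with `x̌₀ = 𝓕u₀` and `(4π²ν)x₀ − cD₃x₀ + B(x₀,x₀) = Π𝓕f₀` coordinatewise;
(D2) a lattice solution `(x, β)` of `(4π²ν)x − βD₃x + B(x,x) = Π𝓕f` (`f` smooth, divergence free,
mean zero) synthesises a smooth divergence-free mean-zero `u` and a smooth `p` with
`u·∇u − νΔu + ∇p − β∂₃u = f` and `𝓕u = x̌`;
(D3) smooth mean-zero `g₁, g₂` give `G₁, G₂ ∈ W` with coordinates `Π𝓕gᵢ` and
`‖G₁ − G₂‖² ≤ ∫‖g₁ − g₂‖²`. [folklore] -/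
theorem stub_latticeDictionary :
    ∀ {W : Submodule ℝ ℓ2}
      (hW : ∀ x : ℓ2, x ∈ W ↔ cw[x] 0 = 0 ∧ (∀ kk : Fin 3 → ℤ, kdot[kk, cw[x] kk] = 0) ∧ IsConjSymm cw[x])
      {B : W → W → W} (hB : ∀ x y : W, cw[B x y] = fun k => FluidPDE.Torus.lerayCoeff k (nl[cf[cw[x]], cf[cw[y]]] k))
      {D₃ : W →L[ℝ] W}
      (hD₃ : ∀ x : W, cw[D₃ x] = fun k => (2 * Real.pi * Complex.I * ((k (2 : Fin 3) : ℤ) : ℂ)) • cf[cw[x]] k),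
    (∀ (ν : ℝ) (f₀ u₀ : 𝕋³ → E³) (p₀ : 𝕋³ → ℝ) (c : ℝ), 0 < ν → IsSmooth f₀ → HasZeroMean f₀ →
      IsSmooth u₀ → IsDivFree u₀ → HasZeroMean u₀ →
      FluidPDE.Torus.IsSteadyNSState ν f₀ (fun x => u₀ x - c • EuclideanSpace.single (2 : Fin 3) (1 : ℝ)) p₀ →
      ∃ x₀ : W, cf[cw[x₀]] = mFourierCoeff (complexify ∘ u₀) ∧
        ∀ k : Fin 3 → ℤ, cw[((4 * Real.pi ^ 2 * ν) • x₀ - c • D₃ x₀ + B x₀ x₀ : W)] k =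
          FluidPDE.Torus.lerayCoeff k (mFourierCoeff (complexify ∘ f₀) k)) ∧
    (∀ (ν : ℝ) (f : 𝕋³ → E³) (x : W) (β : ℝ), 0 < ν → IsSmooth f → IsDivFree f → HasZeroMean f →
      (∀ k : Fin 3 → ℤ, cw[((4 * Real.pi ^ 2 * ν) • x - β • D₃ x + B x x : W)] k =
          FluidPDE.Torus.lerayCoeff k (mFourierCoeff (complexify ∘ f) k)) →
      ∃ (u : 𝕋³ → E³) (p : 𝕋³ → ℝ), IsSmooth u ∧ IsSmooth p ∧ IsDivFree u ∧ HasZeroMean u ∧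
        (∀ y, Torus.convect u u y - ν • Torus.laplacian u y + Torus.gradient p y -
            β • Torus.partialDeriv (2 : Fin 3) u y = f y) ∧
        mFourierCoeff (complexify ∘ u) = cf[cw[x]]) ∧
    (∀ (g₁ g₂ : 𝕋³ → E³), IsSmooth g₁ → HasZeroMean g₁ → IsSmooth g₂ → HasZeroMean g₂ →
      ∃ G₁ G₂ : W, (∀ k : Fin 3 → ℤ, cw[G₁] k = FluidPDE.Torus.lerayCoeff k (mFourierCoeff (complexify ∘ g₁) k)) ∧
        (∀ k : Fin 3 → ℤ, cw[G₂] k = FluidPDE.Torus.lerayCoeff k (mFourierCoeff (complexify ∘ g₂) k)) ∧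
        ‖G₁ - G₂‖ ^ 2 ≤ MeasureTheory.integral MeasureTheory.volume (fun y => ‖g₁ y - g₂ y‖ ^ 2)) := by
  intro W hW B hB D₃ hD₃
  exact ⟨dictionary_baseState hW hB hD₃, dictionary_synthesis hW hB hD₃, dictionary_forces hW⟩

end Summit.AnomalousDissipation.AnomalousDissipation.Theorems.NewtonRealisation.LatticeDictionary

end
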